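import Literature.Geometry.Kaehler.ComplexTorusAnalyticLimitChain
import Literature.Geometry.Kaehler.ComplexTorusEffectiveCycleBoundedDegree
import HarnessLib

/-!
# The degree of the limit chain: no loss of mass, lower semicontinuity of the volume

Layer `Literature/Geometry/Kaehler`; lane `lit-hodgefound`, seat p07, programme «BOUNDED CYCLES ON A
COMPLEX TORUS», file 6. Let `Z_j ⊆ X = E/Λ` be analytic subsets of pure dimension `p = d + 1` of a
complex torus with `[π⁻¹ Z_j] → [T]`, `T ≥ 0` (`ComplexTorusAnalyticLimitChain.lean`). By that file the
volumes `vol(Z_j)` converge to the degree `deg(T/Λ) = Re ∫_{T/Λ} ω^p/p!` of the limit cycle. Here: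

* `HolomorphicChain.re_torusPeriod_kaehlerPow_eq_integral` — **Wirtinger for chains modulo `Λ`**:
  `deg(T/Λ) = ∫_{Φ([0,1)^ι)} θ_T d(𝓗^{2p}⌞reg|T|)` (`ω^p/p!(ξ_T) = 1` on the carrier,
  [Chirka1989, §14.4 Prop. 1; GriffithsHarris1978, Ch. 0 §2]);
  `HolomorphicChain.measureReal_periodBox_inter_carrier_le_re_torusPeriod` — for `T ≥ 0`:
  `𝓗^{2p}(Φ([0,1)^ι) ∩ reg|T|) ≤ deg(T/Λ)` (`θ_T ≥ 1` on the carrier);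
* `ComplexTorus.re_torusPeriod_kaehlerPow_limit_pos`, **`ComplexTorus.limit_ne_zero`** — **NO LOSS OF
  MASS on the compact torus**: `deg(T/Λ) ≥ v > 0` (the uniform lower volume bound of
  `ComplexTorusEffectiveCycleBoundedDegree.lean`, [Chirka1989, §13 / §15.1 Lelong]), so the limit chain
  is NONZERO, its support nonempty (`support_limit_nonempty`), and the limit set `W = π(|T|)` is a closed
  analytic subset of `X` OF PURE DIMENSION `p` (**`hasPureDim_image_cover_support_limit`**, sharpening
  the alternative "`W = ∅` or pure `p`-dimensional" of `ComplexTorusAnalyticLimitSet.lean`)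
  [Chirka1989, §15.5 Thm.; Fujiki1978, §4 Prop. 4.1];
* `ComplexTorus.carrier_analyticChain_image_cover_support` (`reg π⁻¹W = reg|T|` in `E`),
  **`ComplexTorus.volume_image_cover_support_le`**, **`volume_image_cover_support_le_liminf`** —
  **LOWER SEMICONTINUITY OF THE VOLUME**: `vol(W) ≤ deg(T/Λ) = lim_j vol(Z_j)`
  [Chirka1989, §16.1 Prop. 1, p. 207: "`m(A, a) ≥ 1` on `A`"; Fujiki1978, §4 Prop. 4.1].

Theorems only; no new definitions, no named facts.

## References

* [Chirka1989] E. M. Chirka, *Complex Analytic Sets*, Kluwer 1989, §13, §14.4 Prop. 1, §15.1,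
  §15.5 Thm., §16.1 Prop. 1 (pp. 206–207).
* [Fujiki1978] A. Fujiki, *Closedness of the Douady spaces of compact Kähler spaces*, Publ. RIMS 14
  (1978) 1–52, §4 Prop. 4.1.
* [GriffithsHarris1978] P. Griffiths, J. Harris, *Principles of Algebraic Geometry*, Wiley 1978,
  Ch. 0 §2 (Wirtinger).
-/

noncomputable section

open scoped Manifold ENNReal NNReal Topology Distributions
open MeasureTheory TopologicalSpace Set Function Filter Metric Complex
open Literature.Geometry.GeometricMeasureTheory

namespace Literature.Geometry.Kaehler

-- Nested operator-norm instances on `Covector V m` / `Multivector V m`, as in `Currents.lean`.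
set_option maxSynthPendingDepth 2

universe u

/-! ## §1. The degree of a positive chain modulo `Λ` as an integral of the density -/

namespace HolomorphicChain

variable {ι : Type*} [Fintype ι] {E : Type u} [NormedAddCommGroup E] [InnerProductSpace ℂ E]
  [FiniteDimensional ℂ E] [MeasurableSpace E] [BorelSpace E] (Φ : (ι → ℝ) ≃L[ℝ] E) {d : ℕ}

omit [Fintype ι] in
/-- **Wirtinger for chains modulo `Λ`**: `Re ∫_{T/Λ} ω^p/p! = ∫_{Φ([0,1)^ι)} θ_T d(𝓗^{2p}⌞reg|T|)`
(`ω^p/p!(ξ_T) = 1` on the carrier). [cite: Chirka1989, §14.4 Prop. 1; GriffithsHarris1978, Ch. 0 §2] -/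
theorem re_torusPeriod_kaehlerPow_eq_integral (T : HolomorphicChain 𝓘(ℂ, E) (⊤ : Opens E) (d + 1)) :
    (T.torusPeriod Φ (ofRealCLM.compContinuousAlternatingMap (kaehlerPow (d + 1)))).re =
      ∫ x in ComplexTorus.periodBox Φ 0, (T.density x : ℝ)
        ∂((μHE[2 * (d + 1)] : Measure E).restrict T.carrier) := by
  rw [T.torusPeriod_ofReal Φ, ofReal_re]
  refine integral_congr_ae ?_
  filter_upwards [ae_restrict_of_ae (ae_restrict_mem T.measurableSet_carrier)] with x hx
  rw [T.kaehlerPow_orientationFrame_of_mem_carrier hx, mul_one]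

omit [Fintype ι] in
/-- The density of a chain on `E` is integrable on the period box (w.r.t. `𝓗^{2p}⌞reg|T|`).
[cite: Harvey1977, Lemma 1.3] -/
theorem integrableOn_density_periodBox (T : HolomorphicChain 𝓘(ℂ, E) (⊤ : Opens E) (d + 1)) :
    IntegrableOn (fun x ↦ (T.density x : ℝ)) (ComplexTorus.periodBox Φ 0)
      ((μHE[2 * (d + 1)] : Measure E).restrict T.carrier) := by
  have h := (T.integrableOn_density_mul_apply_of_isCompact (ComplexTorus.isCompact_closedPeriodBox Φ 0)
    (η := fun _ ↦ kaehlerPow (d + 1)) continuous_const).mono_set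
    (ComplexTorus.periodBox_subset_closedPeriodBox Φ 0)
  refine h.congr_fun_ae ?_
  filter_upwards [ae_restrict_of_ae (ae_restrict_mem T.measurableSet_carrier)] with x hx
  rw [T.kaehlerPow_orientationFrame_of_mem_carrier hx, mul_one]

omit [Fintype ι] in
/-- `𝓗^{2p}(Φ([0,1)^ι) ∩ reg|T|) < ∞`. [cite: Harvey1977, Lemma 1.3] -/
theorem measure_periodBox_inter_carrier_lt_top (T : HolomorphicChain 𝓘(ℂ, E) (⊤ : Opens E) (d + 1)) :
    (μHE[2 * (d + 1)] : Measure E) (ComplexTorus.periodBox Φ 0 ∩ T.carrier) < ⊤ := by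
  rw [inter_comm]
  exact lt_of_le_of_lt
    (measure_mono (inter_subset_inter_right _ (ComplexTorus.periodBox_subset_closedPeriodBox Φ 0)))
    (T.measure_carrier_inter_lt_top (ComplexTorus.isCompact_closedPeriodBox Φ 0) fun _ _ ↦ trivial)

/-- **For a positive chain, `𝓗^{2p}(Φ([0,1)^ι) ∩ reg|T|) ≤ Re ∫_{T/Λ} ω^p/p!`** (`θ_T ≥ 1` on the
carrier). [cite: Chirka1989, §16.1 Prop. 1, p. 207; §14.4 Prop. 1] -/
theorem measureReal_periodBox_inter_carrier_le_re_torusPeriod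
    (T : HolomorphicChain 𝓘(ℂ, E) (⊤ : Opens E) (d + 1)) (hT : ∀ Y, 0 ≤ T.mult Y) :
    (μHE[2 * (d + 1)] : Measure E).real (ComplexTorus.periodBox Φ 0 ∩ T.carrier) ≤
      (T.torusPeriod Φ (ofRealCLM.compContinuousAlternatingMap (kaehlerPow (d + 1)))).re := by
  rw [T.re_torusPeriod_kaehlerPow_eq_integral Φ]
  set μ : Measure E := (μHE[2 * (d + 1)] : Measure E).restrict T.carrier with hμ
  have hμbox : μ (ComplexTorus.periodBox Φ 0) =
      (μHE[2 * (d + 1)] : Measure E) (ComplexTorus.periodBox Φ 0 ∩ T.carrier) := by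
    rw [hμ, Measure.restrict_apply (ComplexTorus.measurableSet_periodBox Φ 0)]
  have hfin : μ (ComplexTorus.periodBox Φ 0) < ⊤ := by
    rw [hμbox]; exact T.measure_periodBox_inter_carrier_lt_top Φ
  have hae : ∀ᵐ x ∂(μ.restrict (ComplexTorus.periodBox Φ 0)), (1 : ℝ) ≤ T.density x := by
    filter_upwards [ae_restrict_of_ae (ae_restrict_mem T.measurableSet_carrier)] with x hx
    obtain ⟨y, hy, rfl⟩ := hx
    rw [T.density_apply_coe]
    exact_mod_cast T.one_le_multAt_of_mem_support hT hy.1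
  have h1 : ∫ _ in ComplexTorus.periodBox Φ 0, (1 : ℝ) ∂μ =
      (μHE[2 * (d + 1)] : Measure E).real (ComplexTorus.periodBox Φ 0 ∩ T.carrier) := by
    rw [setIntegral_const, smul_eq_mul, mul_one, measureReal_def, measureReal_def, hμbox]
  rw [← h1]
  exact integral_mono_ae (integrableOn_const hfin.ne) (T.integrableOn_density_periodBox Φ) hae

omit [FiniteDimensional ℂ E] [MeasurableSpace E] [BorelSpace E] in
/-- A chain with empty support is zero. [cite: Chirka1989, §12.1] -/
theorem eq_zero_of_support_eq_empty {p : ℕ} (T : HolomorphicChain 𝓘(ℂ, E) (⊤ : Opens E) p)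
    (h : T.support = ∅) : T = 0 := by
  ext Y
  rw [mult_zero, Pi.zero_apply]
  by_contra hY
  obtain ⟨x, hx⟩ := (T.hasPureDim_of_mult_ne_zero hY).nonempty
  have hx' : x ∈ T.support := subset_support hY hx
  rw [h] at hx'
  exact hx'

end HolomorphicChain

/-! ## §2. No loss of mass; the limit set has pure dimension `p`; semicontinuity of the volume -/

namespace ComplexTorus

variable {ι : Type*} [Fintype ι] [DecidableEq ι] {E : Type u} [NormedAddCommGroup E]
  [InnerProductSpace ℂ E] [FiniteDimensional ℂ E] [MeasurableSpace E] [BorelSpace E]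
  (Φ : (ι → ℝ) ≃L[ℝ] E) {d : ℕ}
  {Z : ℕ → Set (ComplexTorus Φ)} (hZ : ∀ j, HasPureDim 𝓘(ℂ, E) (Z j) (d + 1))
  {T : HolomorphicChain 𝓘(ℂ, E) (⊤ : Opens E) (d + 1)}

/-- **No loss of mass**: the degree of the limit cycle is `≥ v > 0`, the uniform lower bound for the
volumes of pure `p`-dimensional analytic subsets of `X`. [cite: Chirka1989, §15.1, §16.1 Prop. 1; Fujiki1978, §4 Prop. 4.1] -/
theorem re_torusPeriod_kaehlerPow_limit_pos (hT : ∀ Y, 0 ≤ T.mult Y)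
    (hconv : ∀ ψ, Tendsto (fun j ↦ (analyticChain Φ (hZ j)).toCurrent ψ) atTop (𝓝 (T.toCurrent ψ))) :
    0 < (T.torusPeriod Φ (ofRealCLM.compContinuousAlternatingMap (kaehlerPow (d + 1)))).re := by
  obtain ⟨v, hv, hvle⟩ := exists_pos_le_volume Φ (d + 1)
  exact hv.trans_le (ge_of_tendsto (tendsto_volume_limit Φ hZ hT hconv)
    (Eventually.of_forall fun j ↦ hvle _ (hZ j)))

/-- **The limit chain is nonzero.** [cite: Chirka1989, §16.1 Prop. 1; Fujiki1978, §4 Prop. 4.1] -/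
theorem limit_ne_zero (hT : ∀ Y, 0 ≤ T.mult Y)
    (hconv : ∀ ψ, Tendsto (fun j ↦ (analyticChain Φ (hZ j)).toCurrent ψ) atTop (𝓝 (T.toCurrent ψ))) :
    T ≠ 0 := by
  intro h0
  have h := re_torusPeriod_kaehlerPow_limit_pos Φ hZ hT hconv
  rw [h0, HolomorphicChain.torusPeriod_ofReal, HolomorphicChain.density_zero] at h
  simp at h

/-- **The support of the limit chain is nonempty.** [cite: Chirka1989, §16.1 Prop. 1; Fujiki1978, §4 Prop. 4.1] -/
theorem support_limit_nonempty (hT : ∀ Y, 0 ≤ T.mult Y)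
    (hconv : ∀ ψ, Tendsto (fun j ↦ (analyticChain Φ (hZ j)).toCurrent ψ) atTop (𝓝 (T.toCurrent ψ))) :
    T.support.Nonempty := by
  by_contra h
  exact limit_ne_zero Φ hZ hT hconv (T.eq_zero_of_support_eq_empty (not_nonempty_iff_eq_empty.1 h))

/-- **The limit set `W = π(|T|)` is a closed analytic subset of `X` of pure dimension `p = d + 1`.**
[cite: Chirka1989, §15.5 Thm., §16.1 Prop. 1; Fujiki1978, §4 Prop. 4.1] -/
theorem hasPureDim_image_cover_support_limit (hT : ∀ Y, 0 ≤ T.mult Y)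
    (hconv : ∀ ψ, Tendsto (fun j ↦ (analyticChain Φ (hZ j)).toCurrent ψ) atTop (𝓝 (T.toCurrent ψ))) :
    HasPureDim 𝓘(ℂ, E) (cover Φ '' (((↑) : (⊤ : Opens E) → E) '' T.support)) (d + 1) := by
  refine (image_cover_support_eq_empty_or_hasPureDim Φ hZ hconv).resolve_left fun h ↦ ?_
  rw [image_eq_empty, image_eq_empty] at h
  exact (support_limit_nonempty Φ hZ hT hconv).ne_empty h

omit [DecidableEq ι] in
/-- `reg π⁻¹W = reg|T|` in `E`: the carrier of `[π⁻¹ W]`, `W = π(|T|)`, is the carrier of `T`.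
[cite: Chirka1989, §16.1 Prop. 1, p. 207] -/
theorem carrier_analyticChain_image_cover_support
    (hconv : ∀ ψ, Tendsto (fun j ↦ (analyticChain Φ (hZ j)).toCurrent ψ) atTop (𝓝 (T.toCurrent ψ)))
    (hW : HasPureDim 𝓘(ℂ, E) (cover Φ '' (((↑) : (⊤ : Opens E) → E) '' T.support)) (d + 1)) :
    (analyticChain Φ hW).carrier = T.carrier := by
  rw [analyticChain, HolomorphicChain.carrier_ofSet, liftSet_image_cover_support Φ hZ hconv,
    HolomorphicChain.carrier]

omit [DecidableEq ι] in
/-- **`vol(W) ≤ deg(T/Λ)`**: the volume of the limit set is at most the degree of the limit cycle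
(the multiplicities of the limit are `≥ 1` on `W`). [cite: Chirka1989, §16.1 Prop. 1, p. 207; Fujiki1978, §4 Prop. 4.1] -/
theorem volume_image_cover_support_le (hT : ∀ Y, 0 ≤ T.mult Y)
    (hconv : ∀ ψ, Tendsto (fun j ↦ (analyticChain Φ (hZ j)).toCurrent ψ) atTop (𝓝 (T.toCurrent ψ)))
    (hW : HasPureDim 𝓘(ℂ, E) (cover Φ '' (((↑) : (⊤ : Opens E) → E) '' T.support)) (d + 1)) :
    (μHE[2 * (d + 1)] : Measure E).real (periodBox Φ 0 ∩ (analyticChain Φ hW).carrier) ≤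
      (T.torusPeriod Φ (ofRealCLM.compContinuousAlternatingMap (kaehlerPow (d + 1)))).re := by
  rw [carrier_analyticChain_image_cover_support Φ hZ hconv hW]
  exact T.measureReal_periodBox_inter_carrier_le_re_torusPeriod Φ hT

/-- **LOWER SEMICONTINUITY OF THE VOLUME**: `vol(W) ≤ lim_j vol(Z_j)` (`= deg(T/Λ)`).
[cite: Chirka1989, §16.1 Prop. 1, p. 207; Fujiki1978, §4 Prop. 4.1] -/
theorem volume_image_cover_support_le_liminf (hT : ∀ Y, 0 ≤ T.mult Y)
    (hconv : ∀ ψ, Tendsto (fun j ↦ (analyticChain Φ (hZ j)).toCurrent ψ) atTop (𝓝 (T.toCurrent ψ)))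
    (hW : HasPureDim 𝓘(ℂ, E) (cover Φ '' (((↑) : (⊤ : Opens E) → E) '' T.support)) (d + 1)) :
    (μHE[2 * (d + 1)] : Measure E).real (periodBox Φ 0 ∩ (analyticChain Φ hW).carrier) ≤
      liminf (fun j ↦ (μHE[2 * (d + 1)] : Measure E).real
        (periodBox Φ 0 ∩ (analyticChain Φ (hZ j)).carrier)) atTop := by
  rw [(tendsto_volume_limit Φ hZ hT hconv).liminf_eq]
  exact volume_image_cover_support_le Φ hZ hT hconv hW

variable {n k : ℕ} (e : Fin n ≃ ι)

/-- **Bishop's theorem on a complex torus, sharpened**: pure `p = d + 1`-dimensional analytic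
`Z_j ⊆ X` with `𝓗^{2p}(π⁻¹Z_j ∩ Φ([0,1)^ι)) ≤ M < ∞` have a subsequence converging (limit set,
neighbourhoods met, open neighbourhoods absorb) to a closed analytic `W ⊆ X` OF PURE DIMENSION `p`,
with `vol(W) ≤ liminf vol(Z_{κ j})` and eventually constant classes `[Z_{κ j}]`.
[cite: Chirka1989, §15.5 Thm., §16.1 Prop. 1; Fujiki1978, §2 Prop. 2.10, §4 Prop. 4.1] -/
theorem exists_subseq_tendsto_analyticSet_hasPureDim_of_measure_le (h : 2 * (d + 1) + k = n)
    {M : ℝ≥0∞} (hM : M < ⊤)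
    (hvol : ∀ j, (μHE[2 * (d + 1)] : Measure E) (cover Φ ⁻¹' Z j ∩ periodBox Φ 0) ≤ M) :
    ∃ (κ : ℕ → ℕ) (W : Set (ComplexTorus Φ)) (hW : HasPureDim 𝓘(ℂ, E) W (d + 1)),
      StrictMono κ ∧ IsClosed W ∧
      (∀ z, z ∈ W ↔ ∀ N : ℕ, z ∈ closure (⋃ j ≥ N, Z (κ j))) ∧
      (∀ z ∈ W, ∀ V ∈ 𝓝 z, ∀ᶠ j in atTop, (Z (κ j) ∩ V).Nonempty) ∧
      (∀ U : Set (ComplexTorus Φ), IsOpen U → W ⊆ U → ∀ᶠ j in atTop, Z (κ j) ⊆ U) ∧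
      (μHE[2 * (d + 1)] : Measure E).real (periodBox Φ 0 ∩ (analyticChain Φ hW).carrier) ≤
        liminf (fun j ↦ (μHE[2 * (d + 1)] : Measure E).real
          (periodBox Φ 0 ∩ (analyticChain Φ (hZ (κ j))).carrier)) atTop ∧
      ∃ N, ∀ j ≥ N, analyticCycleClass Φ e h (hZ (κ j)) = analyticCycleClass Φ e h (hZ (κ N)) := by
  obtain ⟨T, κ, hκ, hconv, hT⟩ := exists_subseq_tendsto_analyticChain Φ hZ hM hvol
  have hZ' : ∀ j, HasPureDim 𝓘(ℂ, E) (Z (κ j)) (d + 1) := fun j ↦ hZ (κ j)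
  have hW := hasPureDim_image_cover_support_limit Φ hZ' hT hconv
  exact ⟨κ, _, hW, hκ, isClosed_image_cover_support Φ hZ' hconv,
    mem_image_cover_support_iff_of_tendsto Φ hZ' hconv,
    fun z hz V hV ↦ eventually_nonempty_inter_of_tendsto Φ hZ' hconv hz hV,
    fun U hU hWU ↦ eventually_subset_of_isOpen_of_tendsto Φ hZ' hconv hU hWU,
    volume_image_cover_support_le_liminf Φ hZ' hT hconv hW,
    eventually_analyticCycleClass_eq_of_tendsto_current Φ e h hZ' hconv⟩

end ComplexTorus

end Literature.Geometry.Kaehler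

end
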